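import Summits.BirchSwinnertonDyer.Rank1Residual.Additive.TameBranchCensusJoin
import Summits.BirchSwinnertonDyer.Rank1Residual.Additive.GordCycRankOneLambda
import Summits.BirchSwinnertonDyer.Rank1Residual.X11a.LambdaNorm
import Literature.NumberTheory.EllipticCurves.PAdicBSDSkinnerUrbanProofs
import HarnessLib

/-!
# Delbourgo 2002, Theorem (C) in the cell's tame-branch currency: the KATO-DIRECTION HALF of the
# rational tame-branch main conjecture — `char_Λ X(E/ℚ_∞) ∣ p^k · B_E` — typed on the WHOLE
# potentially-ordinary additive locus (every defect `e ∈ {2,3,4,6}`, (M) included), and its kernel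
# consequences: n1011-p01's λ-certificate `CharLamLeAt W p n` DISCHARGED from ONE integral tame branch
# with a unit coefficient at index `≤ n`; at rank one Schneider's conjecture for Delbourgo's height,
# the exact valuation identity modulo `μ`, and the LOWER half from one regulator valuation — IMAGE-FREE
# (sub-cell additive-p2 = X3♯(G-ord) / X4♯(G-ord), gen 20; cell `b2b-bsdres`)

HONEST FRAMING (cell `b2b-bsdres`, run/shared/lean/b2b/bsd-rank1-residual/, verbatim in every
file): the goal of the cell is to DELETE the COMBINATION-SHAPED residual classes of the
Birch–Swinnerton-Dyer formula for ALL analytic-rank `≤ 1` elliptic curves over `ℚ` — "full BSD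
formula for every rank `≤ 1` curve in class `C`" assembled STRICTLY from published theorems — so
that the rank-`≤ 1` remainder becomes exactly the CONSTRUCTION-SHAPED classes, which are TYPED
(missing-input `Prop`s), NOT attempted. This is not "finishing BSD". Research route on the
CONSTRUCTION-SHAPED classes X3♯(G-ord) / X4♯(G-ord) (and, formally, the (M) rows): labels UNCHANGED,
NOTHING booked, no named fact minted, ONE typed input (a `def … : Prop` with parameters, nothing
asserted), theorems otherwise; every published input of every consequence is an explicit binder.

## What is in print, and what this file types (READ on the held primary, 2026-08-21)

D. Delbourgo, *On the `p`-adic Birch, Swinnerton-Dyer conjecture for non-semistable reduction*,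
J. Number Theory 95 (2002) 38–71 (held text `paper:delbourgo2002-p-adic-birch-swinnerton-dyer-conjecture-non`,
journal page = text page + 37). p. 39, **Hypothesis**: "Either `E` is potentially ordinary at
`p ≥ 5`; or `E` is potentially ordinary at `p = 3` with semistable reduction over a quadratic
extension of `ℚ₃`." p. 39: "by [De, Theorems 1,2] there is a unique element
`L_p^{an} ∈ ℤ_p⟦G × Δ⟧[μ_p, p⁻¹]` satisfying for all characters `χ ≠ ε` of `p`-power conductor
`χ(L_p^{an}) = p^m / (a^m ∑_{n=1}^{p^m} χ⁻¹ε(n) exp(2πin/p^m)) × L(E, χ⁻¹, 1)/Ω_E^{sign(χ)}`, where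
`m = ord_p(cond(χε⁻¹))`". p. 40, **Theorem.** "Assume that `E` satisfies the Hypothesis. Then (A) …
(B) … **(C) The power series `L_p^{alg}` divides in `ℤ_p⟦G⟧[μ_p, p⁻¹]` the branch of `L_p^{an}` fixed
by `Δ`.** (D) We have the inequality: `order_{s=0} κ^s(L_p^{an}) ≥ r_E`." p. 40: "Clearly, (B) and
(C) together will imply (D)." p. 58, §3, **Proof of Theorem (A), (C)**: "From now on assume that `E`
has no complex multiplication. If `ρ_{E,p}` … then, by a theorem of Serre [Se], `ρ_{E,p}(G_ℚ)` is open
in `GL₂(ℤ_p)` … Now Rohrlich's Theorem [Ro] implies that the values `L(E, χ⁻¹, 1)` are non-zero for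
almost all `χ ∈ X(G)_{tors}`, so applying Proposition 2.3 we see that the element
`(c_{p^m})^Δ_m := (p−1)⁻¹ Tr_Δ (c_{p^m})_m` is not `ℤ_p⟦G⟧`-torsion. … Together the three facts listed
above mean that the conditions of [Ka2, Ru2, PR2] are met"; p. 59: "`char.ideal(H²_{0,S}(T_pE)) p^m ⊇
char.ideal(H¹_S(T_pE)/ℤ_p⟦G⟧·(c_{p^m})^Δ_m)`, where `p^m ∈ p^{ℕ₀}` depends on the image of the Galois
group in `Aut(T_pE)`. For example if `ρ_{E,p}` is surjective … we may take `m = 0`. Unfortunately, in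
the additive reduction case there are infinitely many examples with `Coker(ρ_{E,p})` non-trivial";
p. 60: "the compact Selmer group is zero. Thus … `Sel(E/F_∞)` is cotorsion; furthermore,
`ℤ_p⟦G⟧[μ_p]·L_p^{alg}` contains `p^m L∘loc_p (c_{p^m})^Δ_m = p^m C⁺_E (L_p^{an})^Δ`, which is enough to
prove Theorem (A), (C)." (Bibliography p. 71: `[Ka2]` = Kato, *Euler systems, Iwasawa theory and
Selmer groups*, "preprint" = Kodai Math. J. 22 (1999); `[Ka3]` = Kato, Astérisque 295 (2004), used p. 54
"Kato's Theorem [Ka3, Thm. 9.6]" with `[Ka1]` (generalized explicit reciprocity laws) at `p ∣ cond E`;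
`[Ru2]` = Rubin, *Euler systems*, Ann. of Math. Stud. 147; `[PR2]` = Perrin-Riou, Ann. Inst. Fourier 48
(1998); `[De]` = Delbourgo, Compositio 113 (1998).) PROOF-DEPENDENCY NOTE for the referee (flag
proposed: `Del02-KKT-inprep`): the interpolating homomorphisms of §1 (Lemma on p. 46: "we know from
the work of Kato–Tsuji–Kurihara [KKT] that there exist interpolating homomorphisms", `[KKT]` = "in
preparation", never published; Delbourgo names an alternative route "redo the calculations of [PR1]
… replacing `B_cris` by `B_cris(μ_{p^∞})`") feed Proposition 2.3 and hence BOTH (A) and (C) — the SAME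
dependency set as the accepted fact A175 (`Delbourgo2002.mainTheorem` = (A)+(B), p248323); the
refereed STATEMENT (C) is what is typed below, exactly as (A)+(B) were.

So the Euler-system (UPPER, Kato-direction) half of the tame-branch cyclotomic main conjecture of an
elliptic curve WITHOUT CM at an additive potentially-ORDINARY prime `p ≥ 5` — BOTH the potentially
good (G) locus of EVERY defect `e ∈ {2,3,4,6}` and the potentially multiplicative (M) locus — is a
REFEREED THEOREM, as a RATIONAL divisibility (`p` inverted, `μ_p` adjoined) and with NO image
hypothesis (Serre's open image replaces Kato's (12.5.2); the price `p^m` is invisible rationally).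
This supersedes, for the UPPER half, the cell's literature state "Kato half RATIONALLY = the `ω^i`-form
attributed to Kato by Emerton–Pollack–Weston 2006 Thm. 5.1.2" (`TameBranchLower.lean` §2 docstring;
`GordCycLeadingTerm.lean` located gap R3′: "on defect 3,4,6 BOTH halves of the branch route are
unprinted") — the LOWER (Eisenstein) half on a non-trivial tame branch remains without printed source.

**The object.** cc-typer-2's E-NORMALISED tame branch `B_E ∈ ℚ_p⟦T⟧` (`IsTameBranchOf f p ε α B`,
`TameBranchLower.lean` §1: bounded; `B(0) = α⁻¹[0]⁺_f`; `B(κ(γ)−1) = α^{−m}p⁻¹τ(ε,ψ_κ)·∑_b κ(b)[b/p^m]⁺_f`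
for every wild character `κ` of `Γ` of conductor `p^m`, `m ≥ 2`) IS Delbourgo's `(L_p^{an})^Δ` up to ONE
non-zero constant: with Birch's formula `∑_b κ(b)[b/p^m]⁺_f = τ(κ)L(E,κ̄,1)/Ω⁺_f` and
`|G(χ)|² = p^m`, Delbourgo's value at `κ` is `± a^{−m} G(κε̄)·L(E,κ̄,1)/Ω⁺_E`, and the Gauss-sum identity
`p⁻¹·τ(ε,ψ_κ)·G(κ) = c_ε·G(κε̄)` with `c_ε` INDEPENDENT of `κ` and of `m ≥ 2` (`|c_ε| = p^{−1/2}`; the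
constant of the inverse-twist identity of `TameBranchLower.lean`, re-derived by n1011-lit; checked
numerically by this seat for `(p,e) ∈ {(5,2),(5,4),(7,2),(7,3),(7,6),(13,4)}`, `m ∈ {2,3}`:
HOME/b2b-bsdres-additive-p2/gen20/gauss_ratio.py) gives `B_E = c·(L_p^{an})^Δ`,
`c = ±c_ε·Ω⁺_E/Ω⁺_f ∈ ℚ_p(μ_p)^×`; two bounded functions on the open disc agreeing at all torsion points
of level `≥ 2` coincide. Hence (C) reads: for every generator `fE` of `char_Λ X(E/ℚ_∞)`,
`fE · h = L^Δ` with `h ∈ ℤ_p[μ_p]⟦T⟧[p⁻¹]`, i.e. `fE · h' = p^k · B_E` with `h' ∈ ℤ_p[μ_p]⟦T⟧`, and `h'`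
has `ℚ_p`-coefficients (unique quotient, Galois-invariant): **`p^k · B_E ∈ ι(char_Λ X(E/ℚ_∞))` for some
`k ∈ ℕ`** — the conclusion of `TameBranchRatDvdAt` (§1), which is LITERALLY the divisibility half of
cc-typer-2's typed EQUALITY `TameBranchRatCharEqAt W p` (§2: equality ⟹ divisibility).

**Why a typed input and not (yet) a Literature fact.** The interpolation predicate `IsTameBranchOf`
(with `tameGaussSum`, `tameDefect`, `PotMult`, `TypeGOrd`) is Summits-side vocabulary; a Literature
`def … : Prop` cannot import it. The faithful Literature transcription (interpolation package inlined
in `ratPlusSymbol`/`ratTwistedSymbolSum` terms, `(ε, a)` pinned as printed) is a lit/typer item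
recorded in HOME/OUTWARD-TODO and this seat's NOTES; until it lands, consumers carry
`TameBranchRatDvdAt W p` as an explicit binder exactly as they carry `TameBranchRatCharEqAt W p`, and
the cell's books may read it "IN PRINT (Delbourgo 2002 (C)), typed". ROBUSTNESS of the universal
quantification over `(ε, α)` (shared with `TameBranchRatCharEqAt`): a bounded witness `B̃` for a WRONG
pair (the conjugate character `ε̄` when `e ≥ 3`, or a unit `α' ≠ a`) would satisfy
`B̃(T)·B((1+T)^p−1) = c·B(T)·B̃((1+T)^p−1)` identically (`c = a/α'`; the ratio of prescribed values is
constant along `κ ↦ κ^p` because `ψ_{κ^p} = ψ_κ`), whence, comparing expansions at `T = 0`, `B̃/B` is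
CONSTANT and `c = 1` — impossible, since the prescribed value ratios `τ(ε̄,ψ_κ)/τ(ε,ψ_κ) ∝ ε(c_κ)²` are
not constant for `e ≥ 3` (`exists_apply_mul_tameGaussSum_eq`); so in the presence of the true branch
(Delbourgo 1998 Thm. 1/2 — print, not a tree fact) wrong pairs are VACUOUS rows and the typed statement
says no more than print.

## Contents

* §1 `TameBranchRatDvdAt W p` — TYPED (Delbourgo 2002 (C) in E-normalisation; nothing asserted).
* §2 `tameBranchRatDvdAt_of_tameBranchRatCharEqAt` — the cell's typed rational MC implies it.
* §3 Λ-algebra: `lam_le_of_dvd_of_iota_eq_C_pow_mul` — `fE ∣ g`, `ι g = p^k·B`, `B` `p`-integral with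
  `‖[Tⁿ]B‖ = 1` ⟹ `λ(fE) ≤ n` (RATIONAL divisibility bounds `λ`, never `μ`).
* §4 THE DISCHARGE: `charLamLeAt_of_tameBranchRatDvdAt_of_integral_of_norm_coeff_eq_one` — n1011-p01's
  `CharLamLeAt W p n` (`GordCycRankOneLambda.lean` §0: "intended discharge Delbourgo 2002 Thm. (C) …
  neither object is in the tree") from `TameBranchRatDvdAt` + ONE integral tame branch with a unit
  coefficient at index `n`; torsion companion.
* COMPANION `TameBranchKatoDivisibilityRankOne.lean` (§5–§6): rank ONE (and zero) on the whole (G-ord)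
  cell (`p ≥ 5`, non-CM; EVERY defect; NO image hypothesis, NO Kolyvagin, NO main conjecture) with
  A175 = Delbourgo 2002 (A)+(B): Schneider's `Reg_p(E,Dh) ≠ 0` for EVERY (B)-datum, the identity
  `ord_p #Ш[p^∞] + ord_p Reg_p + ord_p ∏c + ord_p ℓ = μ(X) + rank + 2·ord_p #tors`, the LOWER half from
  ONE regulator valuation or from the typed cyclotomic lower bound, class forms on X4♯(G-ord) /
  X3♯(G-ord), the (M) twin; and the census join on X4-3 (defect `3,4,6`): `OrdinaryTwistPartnerAt` +
  `PlusSymbolsPIntegralAt` + a first-unit-index certificate ⟹ `CharLamLeAt` — the typeG twin of gen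
  19's ONE-NUMBER certificate (`BranchUnitCertificateAt`, defect 2); W1's forthcoming `(μ^an, λ^an)`
  column per typeG row is exactly that certificate's input (rmap-2 GEN 8 (c)(i)).

What is NOT claimed: any `μ`-statement (rational divisibility is blind to `μ`; the UPPER half of
BSD_p needs the INTEGRAL divisibility — Kato 17.4(3)/Wuthrich Thm. 16 on defect 2, nothing printed on
defect 3,4,6); the tame branch's existence (MTT / Delbourgo 1998 Thm. 1–2; on X4-3 it is delivered by
the census input, `exists_isTameBranchOf_of_ordinaryTwistPartnerAt`); any booking.

References: [Delbourgo2002] Thm. (A)–(D) (p. 40), Hypothesis, `L_p^{an}` (p. 39), §3 pp. 58–60;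
[Delbourgo1998] §1.5–1.6, Thm. 1–2, p. 132; [Kato2004Asterisque] (= [Ka2]); [MazurTateTeitelbaum1986Invent]
§I.8, §I.13–I.14; [Washington1997] §7.1; [Miller2011LMS] Def. 1.1; HOME/cells/n1011/ROUTE-2.md §II;
`Additive/TameBranchLower.lean`, `TameBranchUpper.lean`, `TameBranchTeichmuller.lean`,
`TameBranchCensusJoin.lean` (cc-typer-2), `Additive/GordCycRankOneLambda.lean` (n1011-p01),
`Additive/GordRankOneKatoCertificate*.lean` (this seat, gen 19: the defect-2 INTEGRAL twin).
-/

noncomputable section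

open scoped Classical MatrixGroups ModularForm NumberField

open CongruenceSubgroup WeierstrassCurve NumberField Literature.NumberTheory.EllipticCurves
  Literature.NumberTheory.EllipticCurves.ModularForms
  Literature.NumberTheory.EllipticCurves.Rank1Residual
  Literature.NumberTheory.EllipticCurves.Rank1Residual.Typed
  Literature.NumberTheory.EllipticCurves.Delbourgo2002
  Literature.NumberTheory.EllipticCurves.GreenbergVatsal2000
  Summit.BirchSwinnertonDyer.Rank1Residual.X1.MuLambda
  Summit.BirchSwinnertonDyer.Rank1Residual.X1.ParitySqueeze
  Summit.BirchSwinnertonDyer.Rank1Residual.X11a.LambdaNorm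
  IsDedekindDomain

namespace Summit.BirchSwinnertonDyer.Rank1Residual.Additive

/-! ### §1 The typed input: Delbourgo 2002 (C) in E-normalisation -/

/-- **TYPED INPUT (nothing asserted): the KATO-DIRECTION HALF of the rational tame-branch main
conjecture at an additive potentially-ORDINARY prime — `p^k · B_E ∈ ι(char_Λ X(E/ℚ_∞))`.** For the
globally minimal additive curve `E = W` and the odd prime `p` at which `E` is potentially
multiplicative (`PotMult`) or potentially good ordinary of type (G) (`TypeGOrd`): whenever `f` is the
newform of `W`, `ε` is a Dirichlet character mod `p` of exact order `e = tameDefect W p`, `α ∈ ℚ_p` is a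
unit and `B` satisfies the E-normalised tame-branch package `IsTameBranchOf f p ε α B`
(`TameBranchLower.lean` §1), then for the cyclotomic `ℤ_p`-extension with a generator matching the
cyclotomic variable and every Pontryagin-dual datum `D` of `Sel_{p^∞}(W/ℚ_∞)`: `X(W/ℚ_∞)` is
`Λ`-torsion and `ι g = p^k · B` for some `g ∈ char_Λ X(W/ℚ_∞)` and `k ∈ ℕ` (`ι : Λ ↪ ℚ_p⟦T⟧`) — i.e.
every generator `L_p^{alg}` of `char_Λ X` divides `B` in `Λ[p⁻¹]`. Exactly the binders of cc-typer-2's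
`TameBranchRatCharEqAt W p` with its EQUALITY weakened to the divisibility (§2). IN PRINT (module
docstring): Delbourgo, J. Number Theory 95 (2002), Theorem (A)+(C) p. 40 — "(C) The power series
`L_p^{alg}` divides in `ℤ_p⟦G⟧[μ_p, p⁻¹]` the branch of `L_p^{an}` fixed by `Δ`" — for `E` without CM
under the Hypothesis (p. 39: potentially ordinary at `p ≥ 5`, or at `p = 3` with semistable reduction
over a quadratic extension of `ℚ₃`), proved pp. 58–60 from Kato's Euler system, Serre's open image and
Rohrlich's non-vanishing, with NO image hypothesis; `B_E = c·(L_p^{an})^Δ` for one non-zero constant `c`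
(module docstring). Typed here (not a named fact) because the interpolation predicate is Summits
vocabulary; the Literature transcription is owed. A predicate on `(W, p)`; nothing asserted.
[cite: Delbourgo2002, Theorem (A), (C) (p. 40), Hypothesis and `L_p^{an}` (p. 39), §3 pp. 58–60 (shape of the typed input; nothing asserted here)]
[cite: Delbourgo1998, §1.5–1.6, Thm. 1 and p. 132 (the branch; shape)] -/
def TameBranchRatDvdAt (W : WeierstrassCurve ℚ) [W.IsElliptic] [W.IsGloballyMinimal] (p : ℕ)
    [Fact p.Prime] : Prop :=
  ∀ {κ : ZpExtension ℚ p} {γ : Field.absoluteGaloisGroup ℚ} {N : ℕ} [NeZero N]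
    {f : CuspForm (Gamma0 N) 2} (ε : DirichletCharacter ℂ_[p] p) (α : ℚ_[p]) (B : PowerSeries ℚ_[p]),
    p ≠ 2 → Addv W p → (PotMult W p ∨ TypeGOrd W p) →
    κ.IsCyclotomic → κ.IsTopGenerator γ → IsCyclotomicVariable p γ → IsNewformOf W f →
    orderOf ε = tameDefect W p → ‖α‖ = 1 → IsTameBranchOf f p ε α B →
    ∀ D : W.SelmerDualData κ γ,
      D.IsTorsion ∧
      ∃ g ∈ D.charIdeal, ∃ k : ℕ,
        iwasawaToPowerSeries p g = PowerSeries.C ((p : ℚ_[p]) ^ k) * B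

variable (W : WeierstrassCurve ℚ) [W.IsElliptic] [W.IsGloballyMinimal] (p : ℕ) [hp : Fact p.Prime]

/-! ### §2 The cell's typed rational main conjecture implies the typed Kato half -/

/-- **Equality ⟹ divisibility.** cc-typer-2's typed RATIONAL tame-branch main conjecture
`TameBranchRatCharEqAt W p` (`char_Λ X = (g)`, `ι g = p^k · B`, `k ∈ ℤ`) implies the typed Kato half
`TameBranchRatDvdAt W p`: if `k ≥ 0` take `g` itself, if `k < 0` take `p^{−k}·g ∈ (g)` (with exponent
`0`). Bookkeeping. [folklore] -/
theorem tameBranchRatDvdAt_of_tameBranchRatCharEqAt (h : TameBranchRatCharEqAt W p) :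
    TameBranchRatDvdAt W p := by
  intro κ γ N _ f ε α B hp2 hadd hloc hκ hγ hcv hf hε hα hB D
  obtain ⟨hX, g, k, hspan, hι⟩ := h ε α B hp2 hadd hloc hκ hγ hcv hf hε hα hB D
  refine ⟨hX, ?_⟩
  have hp0 : (p : ℚ_[p]) ≠ 0 := Nat.cast_ne_zero.mpr hp.out.ne_zero
  obtain ⟨n, rfl | rfl⟩ := Int.eq_nat_or_neg k
  · refine ⟨g, by rw [hspan]; exact Ideal.mem_span_singleton_self g, n, ?_⟩
    rw [hι, zpow_natCast]
  · refine ⟨PowerSeries.C ((p : ℤ_[p]) ^ n) * g, ?_, 0, ?_⟩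
    · rw [hspan]
      exact Ideal.mul_mem_left _ _ (Ideal.mem_span_singleton_self g)
    · rw [map_mul, Literature.NumberTheory.EllipticCurves.iwasawaToPowerSeries_C_natCast_pow p, hι,
        ← mul_assoc, ← map_mul, zpow_neg, zpow_natCast, mul_inv_cancel₀ (pow_ne_zero n hp0), pow_zero]

/-! ### §3 Λ-algebra: a RATIONAL divisibility by an integral series with a unit coefficient bounds `λ` -/

omit [W.IsElliptic] hp in
variable {W p} [Fact p.Prime] in
/-- An integral power series over `ℚ_p` is in the image of `ι : Λ ↪ ℚ_p⟦T⟧`. [folklore] -/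
theorem exists_iwasawaToPowerSeries_eq_of_norm_coeff_le_one {B : PowerSeries ℚ_[p]}
    (hint : ∀ j : ℕ, ‖PowerSeries.coeff j B‖ ≤ 1) :
    ∃ g₀ : IwasawaAlgebra p, iwasawaToPowerSeries p g₀ = B := by
  refine ⟨PowerSeries.mk fun j ↦ (⟨PowerSeries.coeff j B, hint j⟩ : ℤ_[p]), ?_⟩
  ext j
  rw [Wuthrich2014.coeff_iwasawaToPowerSeries, PowerSeries.coeff_mk]

omit [W.IsElliptic] hp in
variable {W p} [Fact p.Prime] in
/-- **Core of §3.** If `fE ∣ g` in `Λ = ℤ_p⟦T⟧` and `ι g = p^k · B` with `B ∈ ℚ_p⟦T⟧` `p`-INTEGRAL and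
`‖[Tⁿ] B‖_p = 1`, then `λ(fE) ≤ n`: indeed `B = ι g₀` with `g₀ ∈ Λ` of unit content and `λ(g₀) ≤ n`
(the first unit coefficient), `g = p^k · g₀`, and `λ` is additive and blind to `p^k`
(`lam_C_pow_mul`, `lam_le_lam_mul`). A RATIONAL divisibility never bounds `μ`.
[cite: Washington1997, §7.1 (λ-invariant; distinguished polynomials)] -/
theorem lam_le_of_dvd_of_iota_eq_C_pow_mul {fE g : IwasawaAlgebra p} (hdvd : fE ∣ g) {k n : ℕ}
    {B : PowerSeries ℚ_[p]}
    (hι : iwasawaToPowerSeries p g = PowerSeries.C ((p : ℚ_[p]) ^ k) * B)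
    (hint : ∀ j : ℕ, ‖PowerSeries.coeff j B‖ ≤ 1) (hn : ‖PowerSeries.coeff n B‖ = 1) :
    lam fE ≤ n := by
  obtain ⟨g₀, hg₀⟩ := exists_iwasawaToPowerSeries_eq_of_norm_coeff_le_one hint
  -- `g = p^k · g₀` in `Λ`
  have hg : g = PowerSeries.C ((p : ℤ_[p]) ^ k) * g₀ := by
    apply iwasawaToPowerSeries_injective p
    rw [hι, map_mul, Literature.NumberTheory.EllipticCurves.iwasawaToPowerSeries_C_natCast_pow p, hg₀]
  -- `g₀` has a unit coefficient at `n`, hence unit content and `λ(g₀) ≤ n`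
  have hn₀ : ‖(PowerSeries.coeff n g₀ : ℤ_[p])‖ = 1 := by
    rw [PadicInt.norm_def, ← Wuthrich2014.coeff_iwasawaToPowerSeries, hg₀, hn]
  have hμ₀ : HasUnitContent g₀ := (hasUnitContent_iff_exists_norm_eq_one g₀).mpr ⟨n, hn₀⟩
  have hlam₀ : lam g₀ ≤ n := by
    rw [lam_eq_normLam hμ₀]
    exact normLam_le_of_isMaxCoeffAt (isMaxCoeffAt_of_norm_eq_one hn₀)
  have hg₀0 : g₀ ≠ 0 := by
    rintro rfl
    rw [map_zero, norm_zero] at hn₀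
    exact zero_ne_one hn₀
  -- `fE ∣ g = p^k g₀`
  obtain ⟨h, hfac⟩ := hdvd
  have hgne : g ≠ 0 := by
    rw [hg]; exact mul_ne_zero (C_pow_ne_zero k) hg₀0
  have hfE0 : fE ≠ 0 := by
    rintro rfl; exact hgne (by rw [hfac, zero_mul])
  have hh0 : h ≠ 0 := by
    rintro rfl; exact hgne (by rw [hfac, mul_zero])
  calc lam fE ≤ lam (fE * h) := lam_le_lam_mul hfE0 hh0
    _ = lam g := by rw [hfac]
    _ = lam g₀ := by rw [hg, lam_C_pow_mul k hg₀0]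
    _ ≤ n := hlam₀

/-! ### §4 THE DISCHARGE of n1011-p01's λ-certificate `CharLamLeAt W p n` -/

variable {W p}

/-- **`CharLamLeAt W p n` from the typed Kato half and ONE integral tame branch with a unit
coefficient at index `n`.** For `E = W` globally minimal, `p ≠ 2` additive of type (M) or (G-ord), the
typed input `TameBranchRatDvdAt W p` (Delbourgo 2002 (C), module docstring), a tame-branch tuple
`(f, ε, α, B)` with `IsTameBranchOf f p ε α B`, `B` `p`-INTEGRAL (`hint` — on the X4-3 locus the
E-intrinsic `PlusSymbolsPIntegralAt`, `TameBranchUpper.lean`; a THEOREM for irreducible `E[p]` at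
coprime denominators) and `‖[Tⁿ]B‖_p = 1` (`hn`, a finite `p`-adic computation: `λ^{an} ≤ n` with
`μ^{an} = 0` in E-normalisation): then EVERY generator of `char_Λ X(W/ℚ_∞)` for EVERY cyclotomic dual
datum has `λ ≤ n` — n1011-p01's `CharLamLeAt W p n` (`GordCycRankOneLambda.lean`), there "a typed
per-pair input, not a theorem". [cite: Delbourgo2002, Theorem (C) (p. 40)] [cite: Washington1997, §7.1] -/
theorem charLamLeAt_of_tameBranchRatDvdAt_of_integral_of_norm_coeff_eq_one
    (hT : TameBranchRatDvdAt W p)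
    {N : ℕ} [NeZero N] {f : CuspForm (Gamma0 N) 2} {ε : DirichletCharacter ℂ_[p] p} {α : ℚ_[p]}
    {B : PowerSeries ℚ_[p]}
    (hp2 : p ≠ 2) (hadd : Addv W p) (hloc : PotMult W p ∨ TypeGOrd W p)
    (hf : IsNewformOf W f) (hε : orderOf ε = tameDefect W p) (hα : ‖α‖ = 1)
    (hB : IsTameBranchOf f p ε α B) (hint : ∀ j : ℕ, ‖PowerSeries.coeff j B‖ ≤ 1)
    {n : ℕ} (hn : ‖PowerSeries.coeff n B‖ = 1) : CharLamLeAt W p n := by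
  intro κ γ hκ hγ hcv D fE hchar
  obtain ⟨-, g, hg, k, hι⟩ := hT ε α B hp2 hadd hloc hκ hγ hcv hf hε hα hB D
  rw [hchar] at hg
  exact lam_le_of_dvd_of_iota_eq_C_pow_mul (Ideal.mem_span_singleton.mp hg) hι hint hn

/-- **Torsion projection** of the typed input (Delbourgo 2002 (A) in the same currency): given a
tame-branch tuple and a cyclotomic datum whose generator matches the cyclotomic variable, `X(W/ℚ_∞)`
is `Λ`-torsion. (Class-level consumers below take torsion for EVERY generator from A175 =
`Delbourgo2002.mainTheorem` (A) instead.) [cite: Delbourgo2002, Theorem (A) (p. 40)] -/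
theorem isTorsion_of_tameBranchRatDvdAt (hT : TameBranchRatDvdAt W p)
    {N : ℕ} [NeZero N] {f : CuspForm (Gamma0 N) 2} {ε : DirichletCharacter ℂ_[p] p} {α : ℚ_[p]}
    {B : PowerSeries ℚ_[p]}
    (hp2 : p ≠ 2) (hadd : Addv W p) (hloc : PotMult W p ∨ TypeGOrd W p)
    (hf : IsNewformOf W f) (hε : orderOf ε = tameDefect W p) (hα : ‖α‖ = 1)
    (hB : IsTameBranchOf f p ε α B)
    {κ : ZpExtension ℚ p} {γ : Field.absoluteGaloisGroup ℚ} (hκ : κ.IsCyclotomic)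
    (hγ : κ.IsTopGenerator γ) (hcv : IsCyclotomicVariable p γ) (D : W.SelmerDualData κ γ) :
    D.IsTorsion :=
  (hT ε α B hp2 hadd hloc hκ hγ hcv hf hε hα hB D).1

omit [W.IsGloballyMinimal] in
/-- Monotonicity of the λ-certificate predicate in the bound. [folklore] -/
theorem CharLamLeAt.mono {n m : ℕ} (h : CharLamLeAt W p n) (hnm : n ≤ m) : CharLamLeAt W p m :=
  fun κ γ hκ hγ hcv D fE hchar ↦ (h κ γ hκ hγ hcv D fE hchar).trans hnm

end Summit.BirchSwinnertonDyer.Rank1Residual.Additive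

end
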